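import Mathlib
import HarnessLib
import Summits.AtomisticToContinuum.Crystallization.Theorems.PricedLinkCensusSoftFourRingsCapCertEval

/-!
# Bond-to-cap certificate: the valid inequalities behind a certificate: the three-point part summed over `X × X` is nonnegative (polar kernels around the pole), Legendre positivity on `{p} ∪ X` with polynomial weights, and the master inequality

Route `PricedLinkCensus`, item `SoftFourRings` (stmt-AtomisticToContinuum-14234), crux `Cap.BondToCap`
(seat c3).  Part 2/5 of the semantics-and-soundness layer of the certificate checker
(`PricedLinkCensusSoftFourRingsCapCertComp`).  Master valid inequality, for a unit pole `p ∉ X` and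
unit vectors `X` (`u_x = ⟪p,x⟫`, `t_xy = ⟪x,y⟫`): `Σ_{x,y∈X} Ocore(u_x,u_y,t_xy) + Σ_x Dcross(u_x) + c₀ ≥ 0`;
splitting at each `x` into the diagonal, four bonded and seven non-bonded terms and moving the free
polynomials with the degree identities gives `0 ≤ Σ D + Σ O_b + Σ O_n + c₀ ≤ 12α + 48β_b + 84β_n + c₀ < 0`.
-/

namespace Summit.AtomisticToContinuum.Crystallization.Theorems.Cap.Cert

open Real RealInnerProductSpace Finset
open Literature.Geometry.DiscreteGeometry Literature.Geometry.DiscreteGeometry.PolyCert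
  Literature.Geometry.DiscreteGeometry.PolyCert.SPoly

/-! ### The valid inequalities -/

/-- **Legendre positivity on the pole and the configuration, functional weights.**  For a unit
vector `p ∉ X`, unit vectors `X`, a real `β` and any weight function `f`:
`0 ≤ β² L_l(1) + 2β Σ_x f(x) L_l(⟪p,x⟫) + Σ_{x,y} f(x) f(y) L_l(⟪x,y⟫)`, `L_l(t) = legendreI l t 1`.
[folklore] -/
theorem legendre_pole_coupling_fun (l : ℕ) (β : ℝ) (f : EuclideanSpace ℝ (Fin 3) → ℝ)
    {p : EuclideanSpace ℝ (Fin 3)} (hp : ‖p‖ = 1)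
    {X : Finset (EuclideanSpace ℝ (Fin 3))} (hX1 : ∀ x ∈ X, ‖x‖ = 1) (hpX : p ∉ X) :
    0 ≤ β ^ 2 * legendreI l 1 1 + 2 * β * ∑ x ∈ X, f x * legendreI l ⟪p, x⟫ 1 +
      ∑ x ∈ X, ∑ y ∈ X, f x * f y * legendreI l ⟪x, y⟫ 1 := by
  classical
  set c : EuclideanSpace ℝ (Fin 3) → ℝ := fun y => if y = p then β else f y with hc
  have h := sum_sum_legendreI_nonneg l (insert p X) c id
  have hcp : c p = β := by simp [hc]
  have hcx : ∀ x ∈ X, c x = f x := by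
    intro x hx
    have : x ≠ p := fun h => hpX (h ▸ hx)
    simp [hc, this]
  have hnorm : ∀ y ∈ insert p X, ‖y‖ = 1 := by
    intro y hy
    rcases Finset.mem_insert.1 hy with rfl | hy
    · exact hp
    · exact hX1 y hy
  have hpp : ⟪p, p⟫ = 1 := by rw [real_inner_self_eq_norm_sq, hp]; norm_num
  have h1 : ∑ i ∈ insert p X, ∑ j ∈ insert p X,
      c i * c j * legendreI l (inner ℝ (id i) (id j)) (‖id i‖ ^ 2 * ‖id j‖ ^ 2) =
      ∑ i ∈ insert p X, ∑ j ∈ insert p X, c i * c j * legendreI l ⟪i, j⟫ 1 := by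
    refine Finset.sum_congr rfl fun i hi => Finset.sum_congr rfl fun j hj => ?_
    simp only [id]
    rw [hnorm i hi, hnorm j hj]; norm_num
  rw [h1, Finset.sum_insert hpX] at h
  simp_rw [Finset.sum_insert hpX] at h
  rw [Finset.sum_add_distrib] at h
  have e1 : c p * c p * legendreI l ⟪p, p⟫ 1 = β ^ 2 * legendreI l 1 1 := by
    rw [hcp, hpp]; ring
  have e2 : ∑ x ∈ X, c p * c x * legendreI l ⟪p, x⟫ 1 =
      β * ∑ x ∈ X, f x * legendreI l ⟪p, x⟫ 1 := by
    rw [Finset.mul_sum]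
    refine Finset.sum_congr rfl fun x hx => ?_
    rw [hcp, hcx x hx]; ring
  have e3 : ∑ x ∈ X, c x * c p * legendreI l ⟪x, p⟫ 1 =
      β * ∑ x ∈ X, f x * legendreI l ⟪p, x⟫ 1 := by
    rw [Finset.mul_sum]
    refine Finset.sum_congr rfl fun x hx => ?_
    rw [hcp, hcx x hx, real_inner_comm x p]; ring
  have e4 : ∑ x ∈ X, ∑ y ∈ X, c x * c y * legendreI l ⟪x, y⟫ 1 =
      ∑ x ∈ X, ∑ y ∈ X, f x * f y * legendreI l ⟪x, y⟫ 1 := by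
    refine Finset.sum_congr rfl fun x hx => Finset.sum_congr rfl fun y hy => ?_
    rw [hcx x hx, hcx y hy]
  rw [e1, e2, e3, e4] at h
  linarith

/-- **The three-point part summed over `X × X` is nonnegative.** [folklore] -/
theorem sum_sum_F3val_nonneg {p : EuclideanSpace ℝ (Fin 3)} (hp : ‖p‖ = 1)
    {X : Finset (EuclideanSpace ℝ (Fin 3))} (hX1 : ∀ x ∈ X, ‖x‖ = 1) :
    ∀ bs : List TBlk, 0 ≤ ∑ x ∈ X, ∑ y ∈ X, F3val bs ⟪p, x⟫ ⟪p, y⟫ ⟪x, y⟫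
  | [] => by simp [F3val]
  | b :: bs => by
    have hrest := sum_sum_F3val_nonneg hp hX1 bs
    have hsplit : ∀ u v t : ℝ, F3val (b :: bs) u v t =
        (b.ws.map fun w => phiW w u * phiW w v * capQ b.k (t - u * v) ((1 - u ^ 2) * (1 - v ^ 2))).sum
          + F3val bs u v t := by
      intro u v t; simp [F3val]
    simp_rw [hsplit, Finset.sum_add_distrib]
    refine add_nonneg ?_ hrest
    -- inner induction on the weight vectors
    suffices hws : ∀ ws : List (List ℤ), 0 ≤ ∑ x ∈ X, ∑ y ∈ X,
        (ws.map fun w => phiW w ⟪p, x⟫ * phiW w ⟪p, y⟫ *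
          capQ b.k (⟪x, y⟫ - ⟪p, x⟫ * ⟪p, y⟫) ((1 - ⟪p, x⟫ ^ 2) * (1 - ⟪p, y⟫ ^ 2))).sum from hws b.ws
    intro ws
    induction ws with
    | nil => simp
    | cons w ws ih =>
      simp_rw [List.map_cons, List.sum_cons, Finset.sum_add_distrib]
      refine add_nonneg ?_ ih
      have h := sum_sum_capQ_nonneg b.k X (fun x => phiW w ⟪p, x⟫) hp (fun x => x) hX1
      simpa using h

/-- **The Legendre couplings summed over `X × X` (pair part), `X` (point part) and the constant are
nonnegative.** [folklore] -/
theorem legendre_couplings_nonneg {p : EuclideanSpace ℝ (Fin 3)} (hp : ‖p‖ = 1)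
    {X : Finset (EuclideanSpace ℝ (Fin 3))} (hX1 : ∀ x ∈ X, ‖x‖ = 1) (hpX : p ∉ X) :
    ∀ bs : List LBlk, 0 ≤ ∑ x ∈ X, ∑ y ∈ X, LcoupOval bs ⟪p, x⟫ ⟪p, y⟫ ⟪x, y⟫ +
      ∑ x ∈ X, LcoupDval bs ⟪p, x⟫ +
      (bs.map fun b => (b.vs.map fun w => (w.headD 0 : ℝ) ^ 2 * legendreI b.l 1 1).sum).sum
  | [] => by simp [LcoupOval, LcoupDval]
  | b :: bs => by
    have hrest := legendre_couplings_nonneg hp hX1 hpX bs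
    have hO : ∀ u v t : ℝ, LcoupOval (b :: bs) u v t =
        (b.vs.map fun w => phiW w.tail u * phiW w.tail v * legendreI b.l t 1).sum + LcoupOval bs u v t := by
      intro u v t; simp [LcoupOval]
    have hD : ∀ u : ℝ, LcoupDval (b :: bs) u =
        (b.vs.map fun w => 2 * (w.headD 0 : ℝ) * (phiW w.tail u * legendreI b.l u 1)).sum + LcoupDval bs u := by
      intro u; simp [LcoupDval]
    simp_rw [hO, hD, List.map_cons, List.sum_cons, Finset.sum_add_distrib]
    suffices hvs : ∀ vs : List (List ℤ), 0 ≤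
        ∑ x ∈ X, ∑ y ∈ X, (vs.map fun w => phiW w.tail ⟪p, x⟫ * phiW w.tail ⟪p, y⟫ * legendreI b.l ⟪x, y⟫ 1).sum +
        ∑ x ∈ X, (vs.map fun w => 2 * (w.headD 0 : ℝ) * (phiW w.tail ⟪p, x⟫ * legendreI b.l ⟪p, x⟫ 1)).sum +
        (vs.map fun w => (w.headD 0 : ℝ) ^ 2 * legendreI b.l 1 1).sum by
      have := hvs b.vs; linarith
    intro vs
    induction vs with
    | nil => simp
    | cons w vs ih =>
      simp_rw [List.map_cons, List.sum_cons, Finset.sum_add_distrib]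
      have h := legendre_pole_coupling_fun b.l (w.headD 0 : ℝ) (fun x => phiW w.tail ⟪p, x⟫) hp hX1 hpX
      have e : ∑ x ∈ X, 2 * (w.headD 0 : ℝ) * (phiW w.tail ⟪p, x⟫ * legendreI b.l ⟪p, x⟫ 1) =
          2 * (w.headD 0 : ℝ) * ∑ x ∈ X, phiW w.tail ⟪p, x⟫ * legendreI b.l ⟪p, x⟫ 1 := by
        rw [Finset.mul_sum]
      rw [e]
      linarith

/-- **The master valid inequality** of a certificate. [folklore] -/
theorem master_nonneg (c : CapCert) {p : EuclideanSpace ℝ (Fin 3)} (hp : ‖p‖ = 1)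
    {X : Finset (EuclideanSpace ℝ (Fin 3))} (hX1 : ∀ x ∈ X, ‖x‖ = 1) (hpX : p ∉ X) :
    0 ≤ ∑ x ∈ X, ∑ y ∈ X, eval (OcorePoly c) ⟪p, x⟫ ⟪p, y⟫ ⟪x, y⟫ +
      ∑ x ∈ X, LcoupDval c.lb ⟪p, x⟫ + (c0Of c.lb : ℝ) := by
  have h1 := sum_sum_F3val_nonneg hp hX1 c.tb
  have h2 := legendre_couplings_nonneg hp hX1 hpX c.lb
  rw [c0Of_eq]
  have e : ∀ u v t : ℝ, eval (OcorePoly c) u v t = F3val c.tb u v t + LcoupOval c.lb u v t := by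
    intro u v t; rw [OcorePoly, eval_append, eval_F3Poly, eval_LcoupOPoly]
  simp_rw [e, Finset.sum_add_distrib]
  linarith

end Summit.AtomisticToContinuum.Crystallization.Theorems.Cap.Cert
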